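import Summits.RiemannHypothesis.RiemannHypothesis.Theorems.GroundBartaEvenWinsBeyondArchDeflationPanelQLoc2
import Summits.RiemannHypothesis.RiemannHypothesis.Theorems.GroundBartaEvenWinsBeyondArchDeflationPanelQLoc1Four
import Summits.RiemannHypothesis.RiemannHypothesis.Theorems.GroundBartaEvenWinsBeyondArchDeflationEdgeLoc4Four
import HarnessLib

/-!
# RiemannHypothesis / GroundBarta — rung 4 (`EvenWinsBeyondArch`, stmt-RiemannHypothesis-18807 / 18085):
# the deflated Temple L-side beyond `(log 5)/2`, XIX b′ part 2 (four slots) — the edge panel bounds with FOUR prime slots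

Helper file (`--supports stmt-RiemannHypothesis-18807`), RH-free, Mathlib + landed tree files only, no facts.  rh-explicit seat
weil-5 (lead ruling R3-8a, 2026-08-22), four-slot twin of prover B's …DeflationPanelQLoc2: `dt_edgeCheckL4`, `dt_panelELTM4`,
`dt_panelQL_edge4`, the chunked variant `dt_panelELTM4'` / `dt_panelQL_edge4'` — on the bundle `dt_WinL4`, the four-slot edge
models `dt_residualEdgeLocTM4(')` and `dt_edgeBoundL_of_tmem4`.  Proofs = B's with the fourth flag pair threaded through.

References: E. Bombieri, Rend. Mat. Acc. Lincei (9) 11 (2000) Thm 2 [Bombieri2000Weil]; Goerisch–Haunhorst (1985)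
[GoerischHaunhorst1985]; K. Makino, M. Berz (2003).
-/

set_option linter.dupNamespace false

noncomputable section

open MeasureTheory Set Filter intervalIntegral
open scoped Topology BigOperators

namespace Summit.RiemannHypothesis.RiemannHypothesis.Theorems.EvenWinsBeyondArch

open Literature.NumberTheory.LFunctions
open Literature.Analysis.ValidatedNumerics Literature.Analysis.ValidatedNumerics.PolyMP
  Literature.Analysis.ValidatedNumerics.NumericsMP Literature.Analysis.ValidatedNumerics.ExpPoly

section PanelQ4E

variable {S : ℕ} {c : ℚ} {m Dl k : ℕ}

/-- The decidable part of the edge panel (v2): `e^{±y/2}` enclosures, the six flags (constant on the panel), enough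
G-moments, and the `Ψ̃♮`-kernel check. -/
def dt_edgeCheckL4 (S : ℕ) (c : ℚ) (m Dl K : ℕ) (W : dt_WinL4 S c m Dl) (g : Poly) (Ke ke : ℕ) (f1 f2 f3 f4 : Bool × Bool) :
    Bool :=
  dt_bulkCheckL4 S c m Dl W g (m - 1) Ke ke f1 f2 f3 f4 &&
  weilArchTailRegKernelCheck S (c / (2 * m)) Dl K W.Qinv W.eK

/-- The v2 Taylor model of the regular part of the residual of vector `i` on the edge panel. -/
def dt_panelELTM4 (S : ℕ) (c : ℚ) (m Dl K Ke ke : ℕ) (W : dt_WinL4 S c m Dl) (gp : Fin k → Poly) (Mt : ℚ)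
    (Wt : Fin k → Fin k → ℚ) (i : Fin k) (V : dt_VecL S c m Dl (gp i)) (f1 f2 f3 f4 : Bool × Bool) : IPoly :=
  dt_residualEdgeLocTM4 S c m Dl K (gp i) (dt_killPoly gp Mt (Wt i) i) V.tabF W.Dρ W.muF W.M0 W.DG0 W.PsiFar V.Pc V.Ps
    (expRatMI S Ke ke (PolyMP.panelCentre (c / (2 * m)) (m - 1) / 2))
    (expRatMI S Ke ke (-(PolyMP.panelCentre (c / (2 * m)) (m - 1) / 2)))
    (W.Iw1, W.IL1, f1) (W.Iw2, W.IL2, f2) (W.Iw3, W.IL3, f3) (W.Iw4, W.IL4, f4) W.Qinv W.eK W.pK W.C0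

/-- **Edge panel (v2).**  For `m ≥ 2`, `2h ≤ 1`, bundles `W`, `V` and `dt_edgeCheckL` accepting the flags, the explicit residual
of vector `i` satisfies `∫_{-h}^{h} R_i(y_{m−1}+ρ)² ≤ dt_edgeBoundLQ S h (dt_panelELTM …) (Poly.shift g_i c) p l⁻ l⁺`.
[cite: Bombieri2000Weil, Thm 2] [cite: GoerischHaunhorst1985, §2] -/
theorem dt_panelQL_edge4 (hS : 0 < S) (hc : 0 < c) (W : dt_WinL4 S c m Dl) (hm : 2 ≤ m) (hh1 : 2 * (c / (2 * m)) ≤ 1)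
    (gp : Fin k → Poly) (Mt : ℚ) (Wt : Fin k → Fin k → ℚ) (i : Fin k) (V : dt_VecL S c m Dl (gp i))
    {K : ℕ} (hK : 0 < K) {Ke ke : ℕ} {f1 f2 f3 f4 : Bool × Bool}
    (hchk : dt_edgeCheckL4 S c m Dl K W (gp i) Ke ke f1 f2 f3 f4 = true)
    (hRi : IntervalIntegrable (fun ρ ↦
      dt_windowResidual4 (c : ℝ) gp W.w1 W.L1 W.w2 W.L2 W.w3 W.L3 W.w4 W.L4 (Mt : ℝ) (fun a l ↦ (Wt a l : ℝ)) i
        (((PolyMP.panelCentre (c / (2 * m)) (m - 1) : ℚ) : ℝ) + ρ) ^ 2) volume (-((c / (2 * m) : ℚ) : ℝ)) ((c / (2 * m) : ℚ) : ℝ))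
    (p : Poly) :
    ∫ ρ in (-((c / (2 * m) : ℚ) : ℝ))..((c / (2 * m) : ℚ) : ℝ),
        dt_windowResidual4 (c : ℝ) gp W.w1 W.L1 W.w2 W.L2 W.w3 W.L3 W.w4 W.L4 (Mt : ℝ) (fun a l ↦ (Wt a l : ℝ)) i
          (((PolyMP.panelCentre (c / (2 * m)) (m - 1) : ℚ) : ℝ) + ρ) ^ 2 ≤
      ((dt_edgeBoundLQ S (c / (2 * m)) (dt_panelELTM4 S c m Dl K Ke ke W gp Mt Wt i V f1 f2 f3 f4) (Poly.shift (gp i) c) p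
          W.llo W.lhi : ℚ) : ℝ) := by
  unfold dt_edgeCheckL4 dt_bulkCheckL4 at hchk
  simp only [Bool.and_eq_true, decide_eq_true_eq] at hchk
  obtain ⟨⟨⟨⟨⟨⟨⟨⟨⟨⟨⟨he1, he2⟩, hf1a⟩, hf1b⟩, hf2a⟩, hf2b⟩, hf3a⟩, hf3b⟩, hf4a⟩, hf4b⟩, hlenM⟩, hkern⟩ := hchk
  have hm1 : 1 ≤ m := by omega
  have hT := dt_tmem_residualEdgeLocTM4 hS hc hm hh1 Dl hK (gp i) (dt_killPoly gp Mt (Wt i) i) V.htab V.htabl W.Dρ W.hDρl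
    W.hDρ W.hmu W.hM0 hlenM W.hDG0 W.hFar V.hPc V.hPs (dt_mem_expHalf hS he1) (dt_mem_expNegHalf hS he2)
    (W.Iw1, W.IL1, f1) (W.Iw2, W.IL2, f2) (W.Iw3, W.IL3, f3) (W.Iw4, W.IL4, f4) W.hw1 W.hL1 W.hw2 W.hL2 W.hw3 W.hL3 W.hw4 W.hL4 hkern W.pK W.hC0
  exact dt_edgeBoundL_of_tmem4 hS hc hm1 hh1 (gp i) (dt_killPoly gp Mt (Wt i) i) hT
    (fun ρ hρ ↦ ⟨dt_flagMinus_sound hS hf1a W.hL1 hρ, dt_flagPlus_sound hS hf1b W.hL1 hρ,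
      dt_flagMinus_sound hS hf2a W.hL2 hρ, dt_flagPlus_sound hS hf2b W.hL2 hρ,
      dt_flagMinus_sound hS hf3a W.hL3 hρ, dt_flagPlus_sound hS hf3b W.hL3 hρ,
      dt_flagMinus_sound hS hf4a W.hL4 hρ, dt_flagPlus_sound hS hf4b W.hL4 hρ⟩)
    _ (fun ρ _ _ ↦ dt_windowResidual4_panelForm c gp W.w1 W.L1 W.w2 W.L2 W.w3 W.L3 W.w4 W.L4 Mt Wt i _ ρ) hRi p W.hllo W.hlhi W.hlhi0

/-- The chunked v2 Taylor model of the regular part on the edge panel (arch pieces from literals `E1 E2 P1 P2 F1 F2`). -/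
def dt_panelELTM4' (S : ℕ) (c : ℚ) (m Dl K Ke ke : ℕ) (W : dt_WinL4 S c m Dl) (gp : Fin k → Poly) (Mt : ℚ)
    (Wt : Fin k → Fin k → ℚ) (i : Fin k) (V : dt_VecL S c m Dl (gp i)) (f1 f2 f3 f4 : Bool × Bool)
    (E1 E2 P1 P2 F1 F2 : IPoly) (n1 n2 : ℕ) : IPoly :=
  let h : ℚ := c / (2 * m)
  let A0 := (dt_locI S (gp i) (ofRat S (PolyMP.panelCentre (c / (2 * m)) (m - 1))))
  let Gy := ttruncI S h Dl A0
  let Etm := widen0 (taddI E1 E2) ⌈wmomTailQ S h A0 dt_kappaE (fun j ↦ (W.M0.getD j default).hi) (1 + n1 + n2) * S⌉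
  let Htm := dt_archHEdgeTM' S c m Dl A0 W.M0 Gy V.tabF W.muF (fun i ↦ (W.Dρ.getD i default).1)
    (fun i ↦ (W.Dρ.getD i default).2) P1 P2 F1 F2 n1 n2
  dt_residualEdgeLocTM4' S c m Dl K (gp i) (dt_killPoly gp Mt (Wt i) i) W.Dρ W.PsiFar V.Pc V.Ps
    (expRatMI S Ke ke (PolyMP.panelCentre (c / (2 * m)) (m - 1) / 2))
    (expRatMI S Ke ke (-(PolyMP.panelCentre (c / (2 * m)) (m - 1) / 2)))
    (W.Iw1, W.IL1, f1) (W.Iw2, W.IL2, f2) (W.Iw3, W.IL3, f3) (W.Iw4, W.IL4, f4) W.Qinv W.eK W.pK W.C0 Etm Htm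

/-- **Edge panel (v2, chunked for the kernel).**  As `dt_panelQL_edge`, with the six expensive arch pieces entering as
equations `computed chunk = literal` (each its own `decide`): E rows `[1,1+n₁)`, `[1+n₁,1+n₁+n₂)`; panel-0 H rows likewise;
contraction panels `[1,1+nf₁)`, `[1+nf₁, 2m−1)`. [cite: Bombieri2000Weil, Thm 2] [cite: GoerischHaunhorst1985, §2] -/
theorem dt_panelQL_edge4' (hS : 0 < S) (hc : 0 < c) (W : dt_WinL4 S c m Dl) (hm : 2 ≤ m) (hh1 : 2 * (c / (2 * m)) ≤ 1)
    (gp : Fin k → Poly) (Mt : ℚ) (Wt : Fin k → Fin k → ℚ) (i : Fin k) (V : dt_VecL S c m Dl (gp i))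
    {K : ℕ} (hK : 0 < K) {Ke ke : ℕ} {f1 f2 f3 f4 : Bool × Bool}
    (hchk : dt_edgeCheckL4 S c m Dl K W (gp i) Ke ke f1 f2 f3 f4 = true)
    {n1 n2 : ℕ} (hn : 1 + n1 + n2 ≤ (gp i).length) {E1 E2 P1 P2 F1 F2 : IPoly}
    (hE1 : dt_archEChunk S c m Dl (dt_locI S (gp i) (ofRat S (PolyMP.panelCentre (c / (2 * m)) (m - 1)))) W.DG0.1 W.DG0.2 1 n1 = E1)
    (hE2 : dt_archEChunk S c m Dl (dt_locI S (gp i) (ofRat S (PolyMP.panelCentre (c / (2 * m)) (m - 1)))) W.DG0.1 W.DG0.2 (1 + n1) n2 = E2)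
    (hP1 : dt_archH0Chunk S c m Dl (dt_locI S (gp i) (ofRat S (PolyMP.panelCentre (c / (2 * m)) (m - 1)))) W.DG0.1 W.DG0.2 1 n1 = P1)
    (hP2 : dt_archH0Chunk S c m Dl (dt_locI S (gp i) (ofRat S (PolyMP.panelCentre (c / (2 * m)) (m - 1)))) W.DG0.1 W.DG0.2 (1 + n1) n2 = P2)
    {nf1 nf2 : ℕ} (hnf : 1 + nf1 + nf2 = 2 * m - 1)
    (hF1 : dt_contrFoldTM S m (ttruncI S (c / (2 * m)) Dl (dt_locI S (gp i) (ofRat S (PolyMP.panelCentre (c / (2 * m)) (m - 1))))) V.tabF W.muF 1 nf1 = F1)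
    (hF2 : dt_contrFoldTM S m (ttruncI S (c / (2 * m)) Dl (dt_locI S (gp i) (ofRat S (PolyMP.panelCentre (c / (2 * m)) (m - 1))))) V.tabF W.muF (1 + nf1) nf2 = F2)
    (hRi : IntervalIntegrable (fun ρ ↦
      dt_windowResidual4 (c : ℝ) gp W.w1 W.L1 W.w2 W.L2 W.w3 W.L3 W.w4 W.L4 (Mt : ℝ) (fun a l ↦ (Wt a l : ℝ)) i
        (((PolyMP.panelCentre (c / (2 * m)) (m - 1) : ℚ) : ℝ) + ρ) ^ 2) volume (-((c / (2 * m) : ℚ) : ℝ)) ((c / (2 * m) : ℚ) : ℝ))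
    (p : Poly) :
    ∫ ρ in (-((c / (2 * m) : ℚ) : ℝ))..((c / (2 * m) : ℚ) : ℝ),
        dt_windowResidual4 (c : ℝ) gp W.w1 W.L1 W.w2 W.L2 W.w3 W.L3 W.w4 W.L4 (Mt : ℝ) (fun a l ↦ (Wt a l : ℝ)) i
          (((PolyMP.panelCentre (c / (2 * m)) (m - 1) : ℚ) : ℝ) + ρ) ^ 2 ≤
      ((dt_edgeBoundLQ S (c / (2 * m)) (dt_panelELTM4' S c m Dl K Ke ke W gp Mt Wt i V f1 f2 f3 f4 E1 E2 P1 P2 F1 F2 n1 n2)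
          (Poly.shift (gp i) c) p W.llo W.lhi : ℚ) : ℝ) := by
  unfold dt_edgeCheckL4 dt_bulkCheckL4 at hchk
  simp only [Bool.and_eq_true, decide_eq_true_eq] at hchk
  obtain ⟨⟨⟨⟨⟨⟨⟨⟨⟨⟨⟨he1, he2⟩, hf1a⟩, hf1b⟩, hf2a⟩, hf2b⟩, hf3a⟩, hf3b⟩, hf4a⟩, hf4b⟩, hlenM⟩, hkern⟩ := hchk
  have hm1 : 1 ≤ m := by omega
  have hm0 : 0 < m := by omega
  have hmq : (0 : ℚ) < m := by exact_mod_cast hm0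
  have hh0 : 0 < c / (2 * m) := by positivity
  have hgc : Continuous fun x ↦ Poly.eval (gp i) x := Poly.continuous_eval (gp i)
  have hloc := dt_locI_spec hS (gp i) (mem_ofRat S (PolyMP.panelCentre (c / (2 * m)) (m - 1)))
  have hlenA : (dt_locI S (gp i) (ofRat S (PolyMP.panelCentre (c / (2 * m)) (m - 1)))).length ≤ W.M0.length + 1 := by rw [dt_length_locI]; exact hlenM
  have hnA : 1 + n1 + n2 ≤ (dt_locI S (gp i) (ofRat S (PolyMP.panelCentre (c / (2 * m)) (m - 1)))).length := by rw [dt_length_locI]; exact hn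
  have hGy : TMem S (c / (2 * m)) (fun s ↦ Poly.eval (gp i) (((PolyMP.panelCentre (c / (2 * m)) (m - 1) : ℚ) : ℝ) + s))
      (ttruncI S (c / (2 * m)) Dl (dt_locI S (gp i) (ofRat S (PolyMP.panelCentre (c / (2 * m)) (m - 1))))) :=
    tmem_trunc hh0.le Dl (dt_tmem_locI hS (c / (2 * m)) (gp i) (mem_ofRat S _))
  have hW : ∀ j, 1 ≤ j → j < 2 * m →
      TMem S (c / (2 * m)) (fun u ↦ weilArchDensity (((PolyMP.panelCentre (c / (2 * m)) j : ℚ) : ℝ) + u))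
        (W.Dρ.getD j default).1 := by
    intro j hj1 hj2
    have hj : j < W.Dρ.length := by rw [W.hDρl]; exact hj2
    have := W.hDρ ⟨j, hj⟩ hj1
    rwa [List.get_eq_getElem, ← List.getD_eq_getElem (d := default)] at this
  have hE := dt_tmem_archEEdge_chunks hS hc hm0 Dl hloc.1 hloc.2 W.hDG0 W.DG0.2 W.hM0 hlenA hnA hE1 hE2
  have hH := dt_tmem_archHEdge' (Dl := Dl) hS hc hm hgc hloc.1 hloc.2 W.hM0 hlenA W.hDG0 W.DG0.2 hGy V.htab V.htabl hW
    (fun j ↦ (W.Dρ.getD j default).2) W.hmu hnA hP1 hP2 hnf hF1 hF2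
  have hT := dt_tmem_residualEdgeLocTM4' hS hc hm hh1 Dl hK (gp i) (dt_killPoly gp Mt (Wt i) i) W.Dρ W.hDρl W.hDρ hE hH
    W.hFar V.hPc V.hPs (dt_mem_expHalf hS he1) (dt_mem_expNegHalf hS he2)
    (W.Iw1, W.IL1, f1) (W.Iw2, W.IL2, f2) (W.Iw3, W.IL3, f3) (W.Iw4, W.IL4, f4) W.hw1 W.hL1 W.hw2 W.hL2 W.hw3 W.hL3 W.hw4 W.hL4 hkern W.pK W.hC0
  exact dt_edgeBoundL_of_tmem4 hS hc hm1 hh1 (gp i) (dt_killPoly gp Mt (Wt i) i) hT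
    (fun ρ hρ ↦ ⟨dt_flagMinus_sound hS hf1a W.hL1 hρ, dt_flagPlus_sound hS hf1b W.hL1 hρ,
      dt_flagMinus_sound hS hf2a W.hL2 hρ, dt_flagPlus_sound hS hf2b W.hL2 hρ,
      dt_flagMinus_sound hS hf3a W.hL3 hρ, dt_flagPlus_sound hS hf3b W.hL3 hρ,
      dt_flagMinus_sound hS hf4a W.hL4 hρ, dt_flagPlus_sound hS hf4b W.hL4 hρ⟩)
    _ (fun ρ _ _ ↦ dt_windowResidual4_panelForm c gp W.w1 W.L1 W.w2 W.L2 W.w3 W.L3 W.w4 W.L4 Mt Wt i _ ρ) hRi p W.hllo W.hlhi W.hlhi0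

end PanelQ4E

end Summit.RiemannHypothesis.RiemannHypothesis.Theorems.EvenWinsBeyondArch

end
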